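import Summits.ValiantsHypothesis.ValiantsHypothesis.Theorems.TwoProducts.RankThreeAffineToricWronskianLayerTop

/-!
# Toric Wronskians of monomials, part 6: the resonance layer at EVERY DEPTH — support (L0) and domination (W4a)

Sequel of ✓ `…ToricWronskianCorner` (depth 0: `toricW_corner`, p715762) and ✓ `…ToricWronskianLayer{,Det,Top}` (depth 1: `toricW_first_layer`,
`toricW_isDomTop_first_layer`, p717519/p718503/p720062).  For `D = J(·,u)` and monomial columns `X^{e_0..e_{K−1}}`, `W = W_D(X^e)`,
`N = Σ_{i<K} i`, the corner `Σe + N•v` at a vertex `v` of `Newt u` dies to the order of the v-RESONANCE DEFECT `d_v = Σ_c C(r_c,2)` (classes of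
columns with equal `det(e_i, v)`, sizes `r_c`) — val-idea-crit-8 g6 VERDICT #118 (L0)/(L1), port-4 g5 DATUM NOTE-TW-corners §2b (120/120 + 389/389).
THIS FILE proves (L0) and the domination half at every depth, in the following CLASS-DATA form (no gcd / primitive vectors needed): the columns are
`e i = b i + n i • q` for base points `b i`, multipliers `n i : ℕ` and ONE step `q`; a class is a fibre of `b`; ★ `toricWDefect b = #{i<j : b i = b j}`
(`= d_v` for `q = v_prim` and canonical bases; for coarser data the statements below stay true, only weaker).
★★ `toricW_support_layer` — (L0) in SUPPORT FORM, with NO hypothesis: every support point of `W` is `Σe_i + (an N-letter word over supp u with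
AT LEAST d letters s having det(q,s) ≠ 0)` («not collinear with q»).  Mechanism = the ✓ (W1) RAY ENGINE (p711636): `D^a X^{b+n•q} = X^{b+n•q}·Σ_j M^{(b)}_{a,j} n^j`
(`toricW_iterate_eq`, `M^{(b)} = toricW_coef u b q` lower-triangular), so by column-multilinearity ★★ `toricW_class_expansion`:
`W = Σ_{J : Fin K → Fin K} (Π_i n_i^{J i})·X^{Σe}·det[M^{(b_i)}_{k,J i}]_{k,i}`; two columns of one class with `J i = J i'` are IDENTICAL (term = 0,
`toricW_class_term_eq_zero`), otherwise `J` is injective on every class and ★ `toricWDefect_le_sum`: `Σ_i J i ≥ d`; and ★★ `isWordSupp_toricW_coef`: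
`M_{a,j}` is a sum of `a`-letter words with `≥ j` letters from `ε_q = rayEps u q`, all with `det(q,·) ≠ 0` — read off the recursion
`M_{a+1,j} = ε_b M_{a,j} + J(M_{a,j},u) + ε_q M_{a,j−1}` with the word-support predicate `IsWordSupp` (§1; closed under `+`, `·`, `J(·,u)`).
★★ `toricW_isDomTop_layer` — (W4a) DOMINATION: if `v` is the unique `ν`-top of `supp u` and `p` (`wt p < wt v`) strictly dominates every OTHER support
point `s` of `u` with `det(q,s) ≠ 0`, then every support point of `W` other than `T − d•(v−p) = Σe_i + m•v + d•p` (`m + d = N`) is strictly `ν`-below it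
(letters collinear with q weigh `≤ wt v` with equality only at `v`, the others `≤ wt p` with equality only at `p`, and `d ≤ #non-collinear`, `wt p < wt v`;
★ `wt_word_le`).  NOTE the hypothesis is WEAKER than W3c's `(hp, hpv, hp2)`: `p` need not be the second point of `supp u`, only the heaviest point NOT
collinear with `q` — the «collinear second point» case (`det(p₂, v) = 0`) is thereby covered.  ★ `toricW_isUniqueTop_layer`: if moreover the layer
coefficient at that point is `≠ 0`, it is the UNIQUE `ν`-top of `W` and `ν` is not an edge direction of `W` (the located cell, conditional form; the CLOSED
FORM of that coefficient — the hybrid Vandermonde product, `≠ 0 ⟺` NO MERGE — is the sequel `…ToricWronskianDepthForm`, crit-8 #118 (L1)/(W4b)).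
CONSEQUENCE for (TW-flag) (residue sentence rev 6): WITHOUT A MERGE the corner `N•v` is cut to depth EXACTLY `d_v` and, as `ν` sweeps the cone of `v`,
the top runs over `d_v·`(the chain of `conv(supp u ∖ ℝv)` facing `v`) — no edge direction outside the pair directions of `supp u`; new directions come
ONLY from merges (§2c of the NOTE), which stay OPEN.  HONEST LABEL: located cell / structural engine on the OPEN rung 3-AFF (side ladder, crux
`stmt-ValiantsHypothesis-5906` `TwoProducts`); (TW-flag, poly) at MERGES, `OLMLaw`, `RankThreeAffineLaw(Exp)`, `TwoProducts`, PCB, `ResidualLawV25`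
UNMOVED; 0 summit distance; VP ≠ VNP is NOT proved; no summit statement is proved here.  `--supports stmt-ValiantsHypothesis-5906 --as helper`
(val-port-4 g6; critic of record val-idea-crit-8 g6).  New: one ℕ-valued data def (`toricWDefect`) and one support-shape predicate with parameters
(`IsWordSupp`, membership-free like ✓ `IsDomTop`); no instances, no notation, no named facts. [folklore]
-/

noncomputable section
set_option linter.dupNamespace false

namespace Summit.ValiantsHypothesis.ValiantsHypothesis.Theorems.TwoProducts.RankTwoJacobian

open scoped BigOperators
open MvPolynomial
open Literature.LinearAlgebra.Matrix (wronskianMatrix wronskian wronskianMatrix_apply wronskian_def)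

section TowerKernel
open scoped Classical

/-! ### §1 Words over `supp u` and the letters not collinear with `q` -/

/-- `F` is a sum of `a`-LETTER WORDS over `supp u` with at least `j` letters NOT collinear with `q`: every support point of `F` is the sum of a
multiset of `a` exponents of `u`, at least `j` of which have `det(q, ·) ≠ 0`. [folklore] -/
def IsWordSupp (u : Poly2) (q : Expo) (a j : ℕ) (F : Poly2) : Prop :=
  ∀ z ∈ F.support, ∃ w : Multiset Expo, (∀ s ∈ w, s ∈ u.support) ∧ Multiset.card w = a ∧
    j ≤ Multiset.card (w.filter fun s => idet q s ≠ 0) ∧ z = w.sum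

/-- fewer non-collinear letters required. [folklore] -/
theorem IsWordSupp.mono {u : Poly2} {q : Expo} {a j j' : ℕ} {F : Poly2} (h : IsWordSupp u q a j F) (hj : j' ≤ j) :
    IsWordSupp u q a j' F := fun z hz => by obtain ⟨w, hw, hc, hj', hz'⟩ := h z hz; exact ⟨w, hw, hc, hj.trans hj', hz'⟩

/-- smaller supports. [folklore] -/
theorem IsWordSupp.of_support_subset {u : Poly2} {q : Expo} {a j : ℕ} {F G : Poly2} (h : IsWordSupp u q a j F)
    (hG : G.support ⊆ F.support) : IsWordSupp u q a j G := fun z hz => h z (hG hz)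

/-- `0`. [folklore] -/
theorem isWordSupp_zero (u : Poly2) (q : Expo) (a j : ℕ) : IsWordSupp u q a j 0 := fun z hz => by simp at hz

/-- `1` is the empty word. [folklore] -/
theorem isWordSupp_one (u : Poly2) (q : Expo) : IsWordSupp u q 0 0 1 := fun z hz => by
  have hz' : z = 0 := by rw [← C_1, C_apply] at hz; exact Finset.mem_singleton.mp (support_monomial_subset hz)
  exact ⟨0, fun s hs => by simp at hs, rfl, le_rfl, by rw [hz', Multiset.sum_zero]⟩

/-- sums. [folklore] -/
theorem IsWordSupp.add {u : Poly2} {q : Expo} {a j : ℕ} {F G : Poly2} (hF : IsWordSupp u q a j F) (hG : IsWordSupp u q a j G) :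
    IsWordSupp u q a j (F + G) := fun z hz => by
  rcases Finset.mem_union.mp (MvPolynomial.support_add hz) with h | h; exact hF z h; exact hG z h

/-- signs. [folklore] -/
theorem IsWordSupp.units_smul {u : Poly2} {q : Expo} {a j : ℕ} {F : Poly2} (hF : IsWordSupp u q a j F) (w : ℤˣ) :
    IsWordSupp u q a j (w • F) := hF.of_support_subset (support_units_smul_subset w F)

/-- finite sums. [folklore] -/
theorem isWordSupp_sum {ι : Type*} (S : Finset ι) {u : Poly2} {q : Expo} {a j : ℕ} {g : ι → Poly2}
    (h : ∀ i ∈ S, IsWordSupp u q a j (g i)) : IsWordSupp u q a j (∑ i ∈ S, g i) := by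
  induction S using Finset.induction_on with
  | empty => rw [Finset.sum_empty]; exact isWordSupp_zero u q a j
  | insert b S hb ih => rw [Finset.sum_insert hb]; exact (h b (S.mem_insert_self b)).add (ih fun i hi => h i (Finset.mem_insert_of_mem hi))

/-- ★ products: words concatenate. [folklore] -/
theorem IsWordSupp.mul {u : Poly2} {q : Expo} {a j a' j' : ℕ} {F G : Poly2} (hF : IsWordSupp u q a j F)
    (hG : IsWordSupp u q a' j' G) : IsWordSupp u q (a + a') (j + j') (F * G) := fun z hz => by
  obtain ⟨x, hx, y, hy, rfl⟩ := Finset.mem_add.mp (MvPolynomial.support_mul F G hz)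
  obtain ⟨w₁, hw₁, hc₁, hj₁, rfl⟩ := hF x hx
  obtain ⟨w₂, hw₂, hc₂, hj₂, rfl⟩ := hG y hy
  refine ⟨w₁ + w₂, fun s hs => ?_, by rw [Multiset.card_add, hc₁, hc₂], ?_, by rw [Multiset.sum_add]⟩
  · rcases Multiset.mem_add.mp hs with h | h; exact hw₁ s h; exact hw₂ s h
  · rw [Multiset.filter_add, Multiset.card_add]; exact Nat.add_le_add hj₁ hj₂

/-- finite products. [folklore] -/
theorem isWordSupp_prod {ι : Type*} (S : Finset ι) {u : Poly2} {q : Expo} {a j : ι → ℕ} {g : ι → Poly2}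
    (h : ∀ i ∈ S, IsWordSupp u q (a i) (j i) (g i)) : IsWordSupp u q (∑ i ∈ S, a i) (∑ i ∈ S, j i) (∏ i ∈ S, g i) := by
  induction S using Finset.induction_on with
  | empty => rw [Finset.sum_empty, Finset.sum_empty, Finset.prod_empty]; exact isWordSupp_one u q
  | insert b S hb ih =>
    rw [Finset.sum_insert hb, Finset.sum_insert hb, Finset.prod_insert hb]; exact (h b (S.mem_insert_self b)).mul (ih fun i hi => h i (S.mem_insert_of_mem hi))

/-- ★ one `J(·,u)`-step appends one letter of `supp u`. [folklore] -/
theorem IsWordSupp.jac {u : Poly2} {q : Expo} {a j : ℕ} {F : Poly2} (hF : IsWordSupp u q a j F) :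
    IsWordSupp u q (a + 1) j (jac F u) := fun z hz => by
  obtain ⟨x, hx, s, hs, rfl⟩ := Finset.mem_add.mp (support_jac_subset F u hz)
  obtain ⟨w, hw, hc, hj, rfl⟩ := hF x hx
  refine ⟨s ::ₘ w, fun s' hs' => ?_, by rw [Multiset.card_cons, hc], ?_, by rw [Multiset.sum_cons, add_comm]⟩
  · rcases Multiset.mem_cons.mp hs' with h | h; (rw [h]; exact hs); exact hw s' h
  · refine hj.trans (Multiset.card_le_card (Multiset.monotone_filter_left _ (Multiset.le_cons_self w s)))

/-- the ray polynomial `ε_e` is a sum of one-letter words. [folklore] -/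
theorem isWordSupp_rayEps (u : Poly2) (q e : Expo) : IsWordSupp u q 1 0 (rayEps u e) := fun z hz => by
  unfold rayEps at hz
  obtain ⟨s, hs, hss⟩ := Finset.mem_biUnion.mp (support_sum hz)
  have h1 := Finset.mem_singleton.mp (support_monomial_subset hss)
  subst h1
  exact ⟨{z}, fun s' hs' => by rw [Multiset.mem_singleton.mp hs']; exact hs, rfl, Nat.zero_le _, (Multiset.sum_singleton z).symm⟩

/-- ★ `ε_q` is a sum of one-letter words whose letter is NOT collinear with `q` (`det(q, s) ≠ 0` on its support). [folklore] -/
theorem isWordSupp_rayEps_self (u : Poly2) (q : Expo) : IsWordSupp u q 1 1 (rayEps u q) := fun z hz => by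
  unfold rayEps at hz
  obtain ⟨s, hs, hss⟩ := Finset.mem_biUnion.mp (support_sum hz)
  have h1 := Finset.mem_singleton.mp (support_monomial_subset hss)
  subst h1
  rw [MvPolynomial.mem_support_iff, coeff_monomial, if_pos rfl] at hss
  have hq : idet q z ≠ 0 := by rintro h; apply hss; rw [h]; simp
  refine ⟨{z}, fun s' hs' => by rw [Multiset.mem_singleton.mp hs']; exact hs, rfl, ?_, (Multiset.sum_singleton z).symm⟩
  rw [Multiset.filter_singleton, if_pos hq, Multiset.card_singleton]

/-- ★★ THE RAY TABLE HAS DEPTH: `M_{a,j} = toricW_coef u b q a j` (✓ `toricW_iterate_eq`: `D^a X^{b+n•q} = X^{b+n•q} Σ_j M_{a,j} n^j`) is a sum of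
`a`-letter words with AT LEAST `j` letters not collinear with `q` — the `j` factors `ε_q` picked up along the recursion
`M_{a+1,j} = ε_b M_{a,j} + J(M_{a,j}, u) + ε_q M_{a,j−1}`. -/
theorem isWordSupp_toricW_coef (u : Poly2) (b q : Expo) : ∀ a j : ℕ, IsWordSupp u q a j (toricW_coef u b q a j)
  | 0, j => by
    by_cases hj : j = 0
    · subst hj; simp only [toricW_coef, if_true]; exact isWordSupp_one u q
    · simp only [toricW_coef, hj, if_false]; exact isWordSupp_zero u q 0 j
  | a + 1, j => by
    have ih := isWordSupp_toricW_coef u b q a j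
    simp only [toricW_coef]
    refine IsWordSupp.add (IsWordSupp.add ?_ ih.jac) ?_
    · have h := (isWordSupp_rayEps u q b).mul ih
      rw [add_comm 1 a, zero_add] at h
      exact h
    · by_cases hj : j = 0
      · rw [if_pos hj]; exact isWordSupp_zero u q _ _
      · rw [if_neg hj]
        have h := (isWordSupp_rayEps_self u q).mul (isWordSupp_toricW_coef u b q a (j - 1))
        rw [add_comm 1 a, show 1 + (j - 1) = j by omega] at h
        exact h

/-! ### §2 The class expansion of the Wronskian (ray engine ✓ `toricW_iterate_eq`, column-multilinearity of `det`) -/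

/-- the RESONANCE DEFECT of the class data `b` (base points of the columns `e i = b i + n i • q`): the number of pairs `i < j` in the same class,
`d = Σ_c C(r_c, 2)` over the classes (fibres of `b`).  With `q = v_prim` and the canonical bases this is the defect `d_v` of NOTE-TW-corners §2b /
val-idea-crit-8 g6 #118. [folklore] -/
def toricWDefect {K : ℕ} (b : Fin K → Expo) : ℕ :=
  ((Finset.univ : Finset (Fin K × Fin K)).filter fun ij => ij.1 < ij.2 ∧ b ij.1 = b ij.2).card

/-- ★★ **CLASS EXPANSION:** for columns `X^{b_i + n_i•q}`,
`W_{J(·,u)}(X^e) = Σ_{J : Fin K → Fin K} (Π_i n_i^{J i}) · X^{Σe} · det[M^{(b_i)}_{k, J i}]_{k,i}`, `M^{(b)} = toricW_coef u b q`. -/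
theorem toricW_class_expansion (u : Poly2) (q : Expo) {K : ℕ} (e b : Fin K → Expo) (n : Fin K → ℕ) (he : ∀ i, e i = b i + n i • q) :
    wronskian (⇑(jacDer u)) (fun i => monomial (e i) (1 : ℂ)) =
      ∑ J : Fin K → Fin K, monomial (∑ i, e i) (∏ i, ((n i : ℕ) : ℂ) ^ ((J i : Fin K) : ℕ)) *
        (Matrix.of fun k i : Fin K => toricW_coef u (b i) q (k : ℕ) ((J i : Fin K) : ℕ)).det := by
  -- entries as sums over the ray table
  have hentry : ∀ k i : Fin K, wronskianMatrix (⇑(jacDer u)) (fun i => monomial (e i) (1 : ℂ)) k i =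
      ∑ c : Fin K, (monomial (e i) (1 : ℂ) * C (((n i : ℕ) : ℂ) ^ (c : ℕ))) * toricW_coef u (b i) q k c := by
    intro k i
    rw [wronskianMatrix_apply, he i, toricW_iterate_eq, Finset.mul_sum]
    have hsub : Finset.range ((k : ℕ) + 1) ⊆ Finset.range K := Finset.range_subset_range.mpr (by omega)
    rw [Finset.sum_subset hsub fun c _ hnc => by
      rw [toricW_coef_eq_zero u (b i) q k c (by have : ¬ (c < (k : ℕ) + 1) := fun h => hnc (Finset.mem_range.mpr h); omega),
        zero_mul, mul_zero],
      Finset.sum_range]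
    exact Finset.sum_congr rfl fun c _ => by ring
  rw [wronskian_def, Matrix.det_apply]
  simp_rw [hentry]
  -- multilinear expansion of every permutation product
  have hperm : ∀ σ : Equiv.Perm (Fin K),
      (Equiv.Perm.sign σ • ∏ i, ∑ c : Fin K, (monomial (e i) (1 : ℂ) * C (((n i : ℕ) : ℂ) ^ (c : ℕ))) * toricW_coef u (b i) q (σ i) c) =
        ∑ J : Fin K → Fin K, Equiv.Perm.sign σ • ∏ i, (monomial (e i) (1 : ℂ) * C (((n i : ℕ) : ℂ) ^ ((J i : Fin K) : ℕ))) *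
          toricW_coef u (b i) q (σ i) (J i) := by
    intro σ
    rw [Fintype.prod_sum, Finset.smul_sum]
  simp_rw [hperm]
  rw [Finset.sum_comm]
  refine Finset.sum_congr rfl fun J _ => ?_
  rw [← toricW_prod_monomial, ← Matrix.det_mul_row, Matrix.det_apply]
  refine Finset.sum_congr rfl fun σ _ => ?_
  congr 1
  refine Finset.prod_congr rfl fun i _ => ?_
  rw [Matrix.of_apply, Matrix.of_apply, mul_comm (monomial (e i) (1 : ℂ)) (C _), C_mul_monomial, mul_one]

/-- two columns of one class with the same table index are identical: the `J`-term vanishes. [folklore] -/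
theorem toricW_class_term_eq_zero (u : Poly2) (q : Expo) {K : ℕ} (b : Fin K → Expo) (J : Fin K → Fin K) {i i' : Fin K} (hii' : i ≠ i')
    (hb : b i = b i') (hJ : J i = J i') : (Matrix.of fun k i : Fin K => toricW_coef u (b i) q (k : ℕ) ((J i : Fin K) : ℕ)).det = 0 :=
  Matrix.det_zero_of_column_eq hii' fun k => by rw [Matrix.of_apply, Matrix.of_apply, hb, hJ]

/-- every `J`-term is a sum of `N`-letter words with at least `Σ_i J i` letters not collinear with `q`. [folklore] -/
theorem isWordSupp_class_term (u : Poly2) (q : Expo) {K : ℕ} (b : Fin K → Expo) (J : Fin K → Fin K) :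
    IsWordSupp u q (∑ i : Fin K, (i : ℕ)) (∑ i : Fin K, ((J i : Fin K) : ℕ)) (Matrix.of fun k i : Fin K => toricW_coef u (b i) q (k : ℕ) ((J i : Fin K) : ℕ)).det := by
  rw [Matrix.det_apply]
  refine isWordSupp_sum _ fun σ _ => IsWordSupp.units_smul ?_ _
  have h := isWordSupp_prod (Finset.univ : Finset (Fin K)) (u := u) (q := q)
    (a := fun i => ((σ i : Fin K) : ℕ)) (j := fun i => ((J i : Fin K) : ℕ)) (g := fun i => toricW_coef u (b i) q (σ i) (J i))
    (fun i _ => isWordSupp_toricW_coef u (b i) q (σ i) (J i))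
  simp only [Matrix.of_apply]
  rw [Equiv.sum_comp σ (fun i : Fin K => (i : ℕ))] at h
  exact h

/-- ★ COUNTING: a table assignment injective on every class has `Σ_i J i ≥ d` (within a class of size `r` the values are distinct, so they sum to
at least `0 + 1 + ⋯ + (r−1) = C(r,2)`; proved by an injection of same-class pairs into `{(i,t) : t < J i}`). [folklore] -/
theorem toricWDefect_le_sum {K : ℕ} (b : Fin K → Expo) (J : Fin K → Fin K) (hJ : ∀ i i', b i = b i' → J i = J i' → i = i') :
    toricWDefect b ≤ ∑ i : Fin K, ((J i : Fin K) : ℕ) := by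
  -- the target set and its cardinality
  set Q : Finset (Fin K × Fin K) := Finset.univ.filter fun x => x.2 < J x.1 with hQ
  have hcardQ : Q.card = ∑ i : Fin K, ((J i : Fin K) : ℕ) := by
    rw [hQ, Finset.card_filter, Fintype.sum_prod_type]
    refine Finset.sum_congr rfl fun i _ => ?_
    simp only
    rw [← Finset.card_filter, Finset.filter_gt_eq_Iio, Fin.card_Iio]
  rw [← hcardQ]
  unfold toricWDefect
  -- the injection
  refine Finset.card_le_card_of_injOn (fun x => if J x.1 < J x.2 then (x.2, J x.1) else (x.1, J x.2)) (fun x hx => ?_) ?_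
  · obtain ⟨h1, _⟩ := (Finset.mem_filter.mp (Finset.mem_coe.mp hx)).2
    rw [Finset.mem_coe, hQ, Finset.mem_filter]
    refine ⟨Finset.mem_univ _, ?_⟩
    dsimp only
    by_cases h : J x.1 < J x.2
    · rw [if_pos h]; exact h
    · rw [if_neg h]
      rcases lt_or_eq_of_le (not_lt.mp h) with h' | h'
      · exact h'
      · exact absurd (hJ _ _ (Finset.mem_filter.mp (Finset.mem_coe.mp hx)).2.2.symm h') (ne_of_lt h1).symm
  · rintro ⟨i, i'⟩ hx ⟨k, k'⟩ hy hxy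
    obtain ⟨hii', hbi⟩ := (Finset.mem_filter.mp (Finset.mem_coe.mp hx)).2
    obtain ⟨hkk', hbk⟩ := (Finset.mem_filter.mp (Finset.mem_coe.mp hy)).2
    simp only at hii' hbi hkk' hbk hxy
    by_cases h1 : J i < J i'
    · by_cases h2 : J k < J k'
      · rw [if_pos h1, if_pos h2, Prod.mk.injEq] at hxy
        obtain ⟨rfl, hJ'⟩ := hxy
        have := hJ i k (by rw [hbi, hbk]) hJ'
        subst this; rfl
      · rw [if_pos h1, if_neg h2, Prod.mk.injEq] at hxy
        obtain ⟨rfl, hJ'⟩ := hxy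
        have := hJ i k' (by rw [hbi, hbk]) hJ'
        subst this
        exact absurd (hii'.trans hkk') (lt_irrefl _)
    · by_cases h2 : J k < J k'
      · rw [if_neg h1, if_pos h2, Prod.mk.injEq] at hxy
        obtain ⟨rfl, hJ'⟩ := hxy
        have := hJ i' k (by rw [← hbi, hbk]) hJ'
        subst this
        exact absurd (hkk'.trans hii') (lt_irrefl _)
      · rw [if_neg h1, if_neg h2, Prod.mk.injEq] at hxy
        obtain ⟨rfl, hJ'⟩ := hxy
        have := hJ i' k' (by rw [← hbi, ← hbk]) hJ'
        subst this; rfl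

/-- `d ≤ N = Σ_{i<K} i` (so callers can write `N = m + d`). [folklore] -/
theorem toricWDefect_le {K : ℕ} (b : Fin K → Expo) : toricWDefect b ≤ ∑ i : Fin K, (i : ℕ) :=
  toricWDefect_le_sum b id fun _ _ _ h => h

/-! ### §3 The layer: support form (L0) and domination (W4a) -/

/-- ★★ **(L0) SUPPORT FORM — NO HYPOTHESES.** For columns `X^{e_i}`, `e_i = b_i + n_i•q`, every support point of `W_{J(·,u)}(X^e)` is `Σe_i` plus an
`N`-letter word over `supp u` (`N = Σ_{i<K} i`) with AT LEAST `d = toricWDefect b` letters NOT collinear with `q`.  (So the corner `N•v` of a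
vertex `v ∥ q` is cut to depth `d`: val-idea-crit-8 g6 #118 (L0) «supp W ⊆ T − {sums of ≥ d_v elements of (v − (supp u ∖ v))}».) -/
theorem toricW_support_layer (u : Poly2) (q : Expo) {K : ℕ} (e b : Fin K → Expo) (n : Fin K → ℕ) (he : ∀ i, e i = b i + n i • q)
    {z : Expo} (hz : z ∈ (wronskian (⇑(jacDer u)) (fun i => monomial (e i) (1 : ℂ))).support) :
    ∃ w : Multiset Expo, (∀ s ∈ w, s ∈ u.support) ∧ Multiset.card w = ∑ i : Fin K, (i : ℕ) ∧
      toricWDefect b ≤ Multiset.card (w.filter fun s => idet q s ≠ 0) ∧ z = (∑ i, e i) + w.sum := by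
  rw [toricW_class_expansion u q e b n he] at hz
  obtain ⟨J, -, hJz⟩ := Finset.mem_biUnion.mp (support_sum hz)
  -- the `J`-term is non-zero at `z`, so `J` is injective on every class
  have hinj : ∀ i i', b i = b i' → J i = J i' → i = i' := by
    intro i i' hb hJ
    by_contra hne
    rw [toricW_class_term_eq_zero u q b J hne hb hJ, mul_zero, support_zero] at hJz
    exact absurd hJz (Finset.notMem_empty _)
  obtain ⟨x, hx, y, hy, rfl⟩ := Finset.mem_add.mp (MvPolynomial.support_mul _ _ hJz)
  have hx' : x = ∑ i, e i := Finset.mem_singleton.mp (support_monomial_subset hx)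
  obtain ⟨w, hw, hc, hj, rfl⟩ := ((isWordSupp_class_term u q b J).mono (toricWDefect_le_sum b J hinj)) y hy
  exact ⟨w, hw, hc, hj, by rw [hx']⟩

/-- weights of words: the `AddMonoidHom` form of `wt ν`. [folklore] -/
theorem wt_multiset_sum (ν : Fin 2 → ℝ) (w : Multiset Expo) : wt ν w.sum = (w.map (wt ν)).sum := by
  induction w using Multiset.induction_on with
  | empty => rw [Multiset.sum_zero, Multiset.map_zero, Multiset.sum_zero, wt_zero_expo]
  | cons s w ih => rw [Multiset.sum_cons, Multiset.map_cons, Multiset.sum_cons, wt_add, ih]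

/-- the weight of a word is at most `#collinear · wt v + #non-collinear · wt p`, with equality only for the word `v…v p…p`. [folklore] -/
theorem wt_word_le {ν : Fin 2 → ℝ} {u : Poly2} {v p q : Expo} (hv : IsUniqueTop ν u v)
    (hp2 : ∀ s ∈ u.support, s ≠ p → idet q s ≠ 0 → wt ν s < wt ν p) (w : Multiset Expo) (hw : ∀ s ∈ w, s ∈ u.support) :
    (w.map (wt ν)).sum ≤ (Multiset.card (w.filter fun s => ¬ idet q s ≠ 0) : ℝ) * wt ν v +
        (Multiset.card (w.filter fun s => idet q s ≠ 0) : ℝ) * wt ν p ∧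
      ((w.map (wt ν)).sum = (Multiset.card (w.filter fun s => ¬ idet q s ≠ 0) : ℝ) * wt ν v +
        (Multiset.card (w.filter fun s => idet q s ≠ 0) : ℝ) * wt ν p →
        w = Multiset.replicate (Multiset.card (w.filter fun s => ¬ idet q s ≠ 0)) v +
          Multiset.replicate (Multiset.card (w.filter fun s => idet q s ≠ 0)) p) := by
  induction w using Multiset.induction_on with
  | empty => simp
  | cons s w ih =>
    have hs : s ∈ u.support := hw s (Multiset.mem_cons_self s w)
    obtain ⟨ih1, ih2⟩ := ih fun s' hs' => hw s' (Multiset.mem_cons_of_mem hs')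
    rw [Multiset.map_cons, Multiset.sum_cons]
    by_cases hq : idet q s ≠ 0
    · -- a non-collinear letter: bounded by `p`
      have hbs : wt ν s ≤ wt ν p ∧ (wt ν s = wt ν p → s = p) := by
        by_cases hsp : s = p
        · exact ⟨by rw [hsp], fun _ => hsp⟩
        · exact ⟨le_of_lt (hp2 s hs hsp hq), fun h => absurd h (ne_of_lt (hp2 s hs hsp hq))⟩
      have hnq : ¬ (¬ idet q s ≠ 0) := not_not.mpr hq
      rw [Multiset.filter_cons_of_pos (p := fun s => idet q s ≠ 0) w hq,
        Multiset.filter_cons_of_neg (p := fun s => ¬ idet q s ≠ 0) w hnq, Multiset.card_cons]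
      push_cast
      refine ⟨by linarith [hbs.1], fun heq => ?_⟩
      have h1 : wt ν s = wt ν p := le_antisymm hbs.1 (by linarith)
      have h2 : (w.map (wt ν)).sum = (Multiset.card (w.filter fun s => ¬ idet q s ≠ 0) : ℝ) * wt ν v +
          (Multiset.card (w.filter fun s => idet q s ≠ 0) : ℝ) * wt ν p := by linarith
      rw [hbs.2 h1, Multiset.replicate_succ, Multiset.add_cons, ← ih2 h2]
    · -- a collinear letter: bounded by `v`
      have hbs : wt ν s ≤ wt ν v ∧ (wt ν s = wt ν v → s = v) := by
        by_cases hsv : s = v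
        · exact ⟨by rw [hsv], fun _ => hsv⟩
        · exact ⟨le_of_lt (hv.2 s hs hsv), fun h => absurd h (ne_of_lt (hv.2 s hs hsv))⟩
      rw [Multiset.filter_cons_of_pos (p := fun s => ¬ idet q s ≠ 0) w hq,
        Multiset.filter_cons_of_neg (p := fun s => idet q s ≠ 0) w hq, Multiset.card_cons]
      push_cast
      refine ⟨by linarith [hbs.1], fun heq => ?_⟩
      have h1 : wt ν s = wt ν v := le_antisymm hbs.1 (by linarith)
      have h2 : (w.map (wt ν)).sum = (Multiset.card (w.filter fun s => ¬ idet q s ≠ 0) : ℝ) * wt ν v +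
          (Multiset.card (w.filter fun s => idet q s ≠ 0) : ℝ) * wt ν p := by linarith
      rw [hbs.2 h1, Multiset.replicate_succ, Multiset.cons_add, ← ih2 h2]

/-- ★★ **(W4a) DOMINATION AT DEPTH `d`.** Let `v` be the unique `ν`-top of `supp u` and let `p` (`wt p < wt v`) strictly dominate every support point
of `u` NOT collinear with `q` other than itself.  For columns `e_i = b_i + n_i•q` with defect `d = toricWDefect b` and `m + d = N`, EVERY support point of
`W_{J(·,u)}(X^e)` other than `T − d•(v − p) = Σe_i + m•v + d•p` is strictly `ν`-below it.  (W3c's `toricW_isDomTop_first_layer` is the case d = 1 with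
`p` the second support point; here `p` need only dominate the non-collinear letters, so a collinear second point is allowed.)  REMARKS: consistent
hypotheses force `det(q, v) = 0` (else `hp2` at `s = v` contradicts `hpv`); if `p` is collinear with `q`, or `p ∉ supp u`, or the fibres of `b` are finer
than the resonance classes, the located point lies strictly ABOVE `supp W` — domination still holds, and `hnz` of `toricW_isUniqueTop_layer` is then
unattainable. -/
theorem toricW_isDomTop_layer {ν : Fin 2 → ℝ} {u : Poly2} {v p q : Expo} (hv : IsUniqueTop ν u v) (hpv : wt ν p < wt ν v)
    (hp2 : ∀ s ∈ u.support, s ≠ p → idet q s ≠ 0 → wt ν s < wt ν p) {K : ℕ} (e b : Fin K → Expo) (n : Fin K → ℕ)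
    (he : ∀ i, e i = b i + n i • q) {m : ℕ} (hm : m + toricWDefect b = ∑ i : Fin K, (i : ℕ)) :
    IsDomTop ν (wronskian (⇑(jacDer u)) (fun i => monomial (e i) (1 : ℂ))) ((∑ i, e i) + m • v + toricWDefect b • p) := by
  intro z hz hne
  obtain ⟨w, hw, hc, hd, rfl⟩ := toricW_support_layer u q e b n he hz
  obtain ⟨hle, heq⟩ := wt_word_le hv hp2 w hw
  set L := Multiset.card (w.filter fun s => idet q s ≠ 0) with hL
  set L' := Multiset.card (w.filter fun s => ¬ idet q s ≠ 0) with hL'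
  have hLL' : L' + L = ∑ i : Fin K, (i : ℕ) := by
    rw [hL, hL', add_comm, ← Multiset.card_add, Multiset.filter_add_not, hc]
  have hL'm : (L' : ℝ) = m + toricWDefect b - L := by
    have : ((L' + L : ℕ) : ℝ) = ((m + toricWDefect b : ℕ) : ℝ) := by rw [hLL', hm]
    push_cast at this; linarith
  have hdR : (toricWDefect b : ℝ) ≤ L := by exact_mod_cast hd
  have hprod : (L' : ℝ) * wt ν v = (m + toricWDefect b - L) * wt ν v := by rw [hL'm]
  have hkey : 0 ≤ ((L : ℝ) - toricWDefect b) * (wt ν v - wt ν p) := mul_nonneg (by linarith) (by linarith)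
  rw [wt_add, wt_add, wt_add, wt_multiset_sum, wt_nsmul, wt_nsmul]
  rcases lt_or_eq_of_le hle with hlt | heq'
  · nlinarith
  · -- equality in the letter bound: the word is `v^{L'} p^{L}`; then `L = d` would make `z` the top itself
    have hw' := heq heq'
    rcases lt_or_eq_of_le hd with hdl | hdl
    · have hdl' : (toricWDefect b : ℝ) < L := by exact_mod_cast hdl
      have hkey' : 0 < ((L : ℝ) - toricWDefect b) * (wt ν v - wt ν p) := mul_pos (by linarith) (by linarith)
      nlinarith
    · exfalso; apply hne
      have hL'eq : L' = m := by omega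
      rw [hw', Multiset.sum_add, Multiset.sum_replicate, Multiset.sum_replicate, hL'eq, ← hdl, add_assoc]

/-- ★ **(W4a′) THE LOCATED CELL, conditional form:** under the hypotheses of `toricW_isDomTop_layer`, if the layer coefficient at
`Σe_i + m•v + d•p` is non-zero then that point is the UNIQUE `ν`-top of `W_{J(·,u)}(X^e)` and `ν` is NOT an edge direction of `W`.
(The closed form of that coefficient — non-zero iff NO MERGE — is the sequel `…ToricWronskianDepthForm`.) -/
theorem toricW_isUniqueTop_layer {ν : Fin 2 → ℝ} {u : Poly2} {v p q : Expo} (hv : IsUniqueTop ν u v) (hpv : wt ν p < wt ν v)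
    (hp2 : ∀ s ∈ u.support, s ≠ p → idet q s ≠ 0 → wt ν s < wt ν p) {K : ℕ} (e b : Fin K → Expo) (n : Fin K → ℕ)
    (he : ∀ i, e i = b i + n i • q) {m : ℕ} (hm : m + toricWDefect b = ∑ i : Fin K, (i : ℕ))
    (hnz : coeff ((∑ i, e i) + m • v + toricWDefect b • p) (wronskian (⇑(jacDer u)) (fun i => monomial (e i) (1 : ℂ))) ≠ 0) :
    IsUniqueTop ν (wronskian (⇑(jacDer u)) (fun i => monomial (e i) (1 : ℂ))) ((∑ i, e i) + m • v + toricWDefect b • p) ∧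
      ¬ IsEdgeDir ν (wronskian (⇑(jacDer u)) (fun i => monomial (e i) (1 : ℂ))) := by
  have htop := isUniqueTop_of_isDomTop (toricW_isDomTop_layer hv hpv hp2 e b n he hm) hnz
  exact ⟨htop, fun hE => not_tie_of_utop ((isUniqueTop_iff _ _ _).mp htop) ((isEdgeDir_iff_tie _ _).mp hE)⟩


end TowerKernel

end Summit.ValiantsHypothesis.ValiantsHypothesis.Theorems.TwoProducts.RankTwoJacobian

end
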